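/-
Copyright (c) 2026. All rights reserved.
Released under Apache 2.0 license as described in the file LICENSE.
Authors: abc-iut cell, prover seat abc-iut-f-028 (F fact-proving wave, tranche 196 re-pointed), over the statements of abc-iut-L5-t4.
-/
import Literature.IUT.HodgeTheaters.ThetaPMEllHodgeTheatersF
import Literature.IUT.HodgeTheaters.PMBaseBridgePropsProofs2
import Literature.IUT.HodgeTheaters.PMBaseBridgePropsProofs3
import Literature.IUT.HodgeTheaters.PMBaseBridgePropsProofs8
import HarnessLib

/-!
# [IUTchI] Cor 6.12 (i)/(ii), Rmk 6.12.1 at the `ℱ`-level: the universal closures of `Cor612iF`,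
# `GluingTorsorF`, `FunctorialDynamicsPMF` over ALL `ℱ`-kits are FALSE (kernel census, proof-only)

S. Mochizuki, *Inter-universal Teichmüller theory I*, kurims manuscript (May 2020), §6: Cor 6.12 (i), (ii)
p. 173 ("follow[s] immediately from Definition 6.11; Corollary 5.3, (ii)"), Rmk 6.12.1 p. 174
[claim: Mochizuki2012, status: disputed].  PROOF-ONLY companion (theorems only: no `def`, no `instance`,
no `structure`) of abc-iut-L5-t4's `ThetaPMEllHodgeTheatersF.lean`, whose named `Prop`s
`PMBaseKit.FKit.Cor612iF`, `PMBaseKit.FKit.GluingTorsorF`, `PMBaseKit.FKit.FunctorialDynamicsPMF`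
(FACT-LIST rows F-2605, F-2607, F-2608) are PROVED there (and in `ThetaPMEllHodgeTheatersFProofs.lean`)
GIVEN Cor 5.3 (ii) `FKit.IsomFtoDBijective` — "the natural map `Isom(¹𝔉, ²𝔉) → Isom(¹𝔇, ²𝔇)` is
bijective" — BY NAME (`cor612iF_of_isomFtoDBijective`, `gluingTorsorF_of_isomFtoDBijective`,
`functorialDynamicsPMF_of_isomFtoDBijective`).

This file records, kernel-checked, that the dependence on Cor 5.3 (ii) is GENUINE: the three named
statements are predicates on the abstract `ℱ`-kit `FK : K.FKit M` (Def 5.2), and their universal closures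
over all kits are FALSE.  Witness (`exists_fat_kit`): over abc-iut-L5's toy base kit `toyKit l hl`
(`𝕍 = {pt}`, model `𝒟_v` with `Aut = {±1}`) and `MultKit.toy`, the "fat" `ℱ`-kit whose ambient category at
the place is the one-object groupoid on `{±1} × ℤ` with base functor `𝔉 ↦ 𝔇` = first projection: `𝔉 ↦ 𝔇`
is SURJECTIVE but NOT INJECTIVE on isomorphisms (the injectivity half of Cor 5.3 (ii) fails).  For the
Θ^{±ell}-Hodge theater `T` over it modelled on Examples 6.2 (i)/6.3 (i):

* `¬ ThetaPMBridge.IsoFToDBijective T.pmBridge T.pmBridge` — one isomorphism of the associated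
  `𝒟-Θ^±`-bridges (Prop 6.6 (i), DISCHARGED `DThetaPMBridge.isoTorsor`) has two distinct `ℱ`-level lifts
  (Def 6.11 (i): all lifts of `†𝔇_≻ ⥲ ‡𝔇_≻` vs. the lifts with trivial `ℤ`-component), so `IsoF.toD` is not
  injective; hence `¬ FK.Cor612iF` (`exists_fkit_not_cor612iF`, `not_forall_cor612iF`);
* `¬ FK.GluingTorsorF T.pmBridge T.ellBridge` — over the index bijection of a `𝒟`-level gluing datum
  (Prop 6.6 (iv), DISCHARGED `DThetaPMBridge.gluingTorsor`) the `ℱ`-level gluing data that glue form an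
  INFINITE set (one per `m ∈ ℤ`), not a `{±1}^𝕍`-torsor (`not_forall_gluingTorsorF`);
* `Infinite (ThetaEllBridge.IsoF T.ellBridge T.ellBridge)`, so `Nat.card = 0 ≠ 2·|T| = 2l`:
  `¬ FK.FunctorialDynamicsPMF` (`not_forall_functorialDynamicsPMF`).

* (appended) `exists_fat_kit_isoF`: at ALL THREE levels (Θ^±-bridges, Θ^{ell}-bridges, Θ^{±ell}-Hodge
  theaters) `IsoF.toD` is not injective over the fat kit — row F-2604 `IsoFToDBijective`
  (`not_forall_thetaPMBridge_isoFToDBijective`, `not_forall_thetaEllBridge_isoFToDBijective`,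
  `not_forall_thetaPMEllHT_isoFToDBijective`).

So rows F-2604/F-2605/F-2607/F-2608 are SCHEMATA over the kit (R5): universal closure REFUTED; instance forms
= the conditional closers above (under Cor 5.3 (ii)), unconditional over `FKit.ofBase` / `FKit.toy`
where Cor 5.3 (ii) is proved (`isomFtoDBijective_ofBase`, `isomFtoDBijective_toy`).  Companion of
abc-iut-L5's `FPrimeStripsRigidity.lean` (a RIGID `ℱ`-kit where the surjectivity half of Cor 5.3 (ii)
fails).  HONEST LABEL: toy / closed term; a statement about the INTERFACE, not about the genuine tempered
Frobenioids.  Nothing of [IUTchI] is asserted; no side taken on [IUTchIII] Cor 3.12; typed ≠ proved.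
-/

namespace Literature.IUT.HodgeTheaters

open CategoryTheory

namespace PMBaseKit

namespace FKit

/-- A `+`-full poly-isomorphism of `𝒟`-prime-strips is nonempty (it is the `Aut_+`-orbit of an
isomorphism, which contains that isomorphism). ([IUTchI] Def 6.1 (iv) p.157) [claim: Mochizuki2012, status: disputed] -/
theorem _root_.Literature.IUT.HodgeTheaters.PMBaseKit.DStrip.IsPlusFullPolyIso.nonempty
    {l : ℕ} {K : PMBaseKit l} {D₁ D₂ : K.DStrip} {P : Set (D₁.Iso D₂)}
    (hP : DStrip.IsPlusFullPolyIso P) : P.Nonempty := by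
  obtain ⟨φ, rfl⟩ := hP
  exact ⟨φ, 1, one_mem _, by funext v; exact (Iso.trans_refl (φ v)).symm⟩

/-- **The fat `ℱ`-kit** ([IUTchI] Def 5.2 / Def 6.11 / Cor 6.12 p.173, INTERFACE LEVEL): over the toy
base kit (prime `l ≠ 2`) there are an `ℱ`-kit `FK` and a Θ^{±ell}-Hodge theater `T` over it (index set
`𝔽_l`, `𝒟`-data those of Examples 6.2 (i)/6.3 (i)) such that (1) `IsoF.toD` on the Θ^±-bridge of `T` is
not bijective, (2) the `ℱ`-level gluing statement `GluingTorsorF` fails for `(T.pmBridge, T.ellBridge)`,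
(3) the `ℱ`-level isomorphisms of the Θ^{ell}-bridge of `T` form an infinite set, and `|T| = l`.  The kit:
ambient category `SingleObj ({±1} × ℤ)` at the place, `𝔉 ↦ 𝔇` the first projection onto
`Aut(𝒟_v) = {±1}` — surjective, not injective, on isomorphisms. [claim: Mochizuki2012, status: disputed] -/
theorem exists_fat_kit (l : ℕ) [Fact l.Prime] (hl : l ≠ 2) :
    ∃ (FK : (toyKit l hl).FKit (MultKit.toy l hl)) (T : FK.ThetaPMEllHT),
      ¬ ThetaPMBridge.IsoFToDBijective T.pmBridge T.pmBridge ∧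
        ¬ FK.GluingTorsorF T.pmBridge T.ellBridge ∧
          Infinite (ThetaEllBridge.IsoF T.ellBridge T.ellBridge) ∧ Nat.card T.T = l := by
  classical
  haveI : NeZero l := ⟨(Fact.out : l.Prime).ne_zero⟩
  let H : Type := ℤˣ × Multiplicative ℤ
  let K : PMBaseKit.{0} l := toyKit l hl
  let M : K.MultKit := MultKit.toy l hl
  -- the base functor `𝔉 ↦ 𝔇` at the place: forget the `ℤ`-factor
  let π : SingleObj H ⥤ Model.Obj l :=
    { obj := fun _ => Model.Obj.loc
      map := fun f => (show H from f).1
      map_id := fun _ => rfl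
      map_comp := fun _ _ => rfl }
  let FK : K.FKit M :=
    { FAmb := fun _ => SingleObj H
      fModel := fun _ => SingleObj.star H
      FmAmb := fun _ => SingleObj H
      fmModel := fun _ => SingleObj.star H
      toD := fun _ => π
      toD_model := fun _ => Iso.refl _
      toFm := fun _ => 𝟭 _
      toFm_model := fun _ => Iso.refl _
      RlfAmb := ∀ _ : K.V, SingleObj H
      rlfModel := fun _ => SingleObj.star H
      rlfFm := fun v => Pi.eval _ v
      rlfOf := fun F => F
      rlfOfMap := fun φ => Pi.isoMk φ
      rlfFm_rlfOf := fun _ _ => Iso.refl _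
      ThAmb := fun _ => SingleObj H
      thModel := fun _ => SingleObj.star H
      thToF := fun _ => 𝟭 _
      thToF_model := fun _ => Iso.refl _
      toDm := fun _ => SingleObj.star _
      toDmMap := fun _ => 𝟙 _
      toDm_toFm := fun _ _ => ⟨𝟙 _⟩ }
  let S : FK.FStrip := ⟨fun _ => SingleObj.star H, fun _ => ⟨Iso.refl _⟩⟩
  let T : FK.ThetaPMEllHT :=
    { T := ZMod l
      grpT := FlPMGroup.tautological l
      capsule := fun _ => S
      codomain := S
      glob := K.gModel
      dPolyPM := Ex62.poly K
      dPolyEll := Ex63.poly K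
      exists_model := (Ex62.ht K).exists_model }
  -- lifting a `𝒟`-isomorphism `†𝔇 ⥲ ‡𝔇` (all strips here are `S`) with prescribed `ℤ`-component
  let lift : (S.assocD.Iso S.assocD) → Multiplicative ℤ → S.Iso S := fun φ m v =>
    (Groupoid.isoEquivHom (SingleObj.star H) (SingleObj.star H)).symm ((φ v).hom, m)
  have lift_assocD : ∀ φ m, FStrip.assocDMap (lift φ m) = φ := by
    intro φ m
    funext v
    ext
    rfl
  -- the `ℤ`-component of an `ℱ`-level isomorphism at the (unique) place
  let snd : S.Iso S → Multiplicative ℤ := fun ψ => (show H from (ψ ()).hom).2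
  have snd_lift : ∀ φ m, snd (lift φ m) = m := fun _ _ => rfl
  -- the lifts of a `𝒟`-poly-isomorphism `P` with `ℤ`-component `m`
  let liftAt : Set (S.assocD.Iso S.assocD) → Multiplicative ℤ → Set (S.Iso S) := fun P m =>
    {ψ | FStrip.assocDMap ψ ∈ P ∧ snd ψ = m}
  have image_liftAt : ∀ P m, FStrip.assocDMap '' liftAt P m = P := by
    intro P m
    apply le_antisymm
    · rintro _ ⟨ψ, hψ, rfl⟩
      exact hψ.1
    · intro φ hφ
      exact ⟨lift φ m, ⟨show FStrip.assocDMap (lift φ m) ∈ P from Set.mem_of_eq_of_mem (lift_assocD φ m) hφ,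
        snd_lift φ m⟩, lift_assocD φ m⟩
  have image_liftPoly : ∀ P : Set (S.assocD.Iso S.assocD), FStrip.assocDMap '' liftPoly P = P := by
    intro P
    apply le_antisymm
    · rintro _ ⟨ψ, hψ, rfl⟩
      exact hψ
    · intro φ hφ
      exact ⟨lift φ 1, show FStrip.assocDMap (lift φ 1) ∈ P from Set.mem_of_eq_of_mem (lift_assocD φ 1) hφ,
        lift_assocD φ 1⟩
  -- `snd` recovers `m` from any nonempty `liftAt P m`
  have snd_image_liftAt : ∀ P : Set (S.assocD.Iso S.assocD), P.Nonempty → ∀ m,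
      snd '' liftAt P m = {m} := by
    intro P hP m
    apply le_antisymm
    · rintro _ ⟨ψ, hψ, rfl⟩
      exact hψ.2
    · intro x hx
      rw [Set.mem_singleton_iff.mp hx]
      obtain ⟨φ, hφ⟩ := hP
      exact ⟨lift φ m, ⟨show FStrip.assocDMap (lift φ m) ∈ P from Set.mem_of_eq_of_mem (lift_assocD φ m) hφ,
        snd_lift φ m⟩, snd_lift φ m⟩
  have one_ne : (Multiplicative.ofAdd (1 : ℤ)) ≠ (1 : Multiplicative ℤ) := by decide
  refine ⟨FK, T, ?_, ?_, ?_, Nat.card_zmod l⟩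
  · -- (1) `IsoF.toD` is not injective on the Θ^±-bridge of `T`
    intro hbij
    obtain ⟨⟨g⟩, -⟩ := DThetaPMBridge.isoTorsor T.pmBridge.dBridge T.pmBridge.dBridge ⟨()⟩
    let G₁ : ThetaPMBridge.IsoF T.pmBridge T.pmBridge :=
      ⟨g, fun t => liftPoly (g.capsPoly t), liftPoly g.codPoly, fun t => image_liftPoly _, image_liftPoly _⟩
    let G₂ : ThetaPMBridge.IsoF T.pmBridge T.pmBridge :=
      ⟨g, fun t => liftPoly (g.capsPoly t), liftAt g.codPoly 1, fun t => image_liftPoly _, image_liftAt _ 1⟩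
    have hne : G₁ ≠ G₂ := by
      intro h
      have hcod : liftPoly g.codPoly = liftAt g.codPoly 1 := congrArg ThetaPMBridge.IsoF.codPoly h
      obtain ⟨φ, hφ⟩ := g.codPoly_plusFull.nonempty
      have hmem : lift φ (Multiplicative.ofAdd 1) ∈ liftPoly g.codPoly :=
        show FStrip.assocDMap (lift φ (Multiplicative.ofAdd 1)) ∈ g.codPoly from
          Set.mem_of_eq_of_mem (lift_assocD φ _) hφ
      rw [hcod] at hmem
      have h2 : snd (lift φ (Multiplicative.ofAdd 1)) = 1 := hmem.2
      rw [snd_lift] at h2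
      exact one_ne h2
    exact hne (hbij.1 (rfl : G₁.toD = G₂.toD))
  · -- (2) the `ℱ`-level gluing data over one index bijection are infinitely many
    intro hGT
    obtain ⟨⟨G₀, hG₀⟩, -, -⟩ := DThetaPMBridge.gluingTorsor T.pmBridge.dBridge T.ellBridge.dBridge ⟨()⟩
    obtain ⟨ι₀, poly₀, pf₀⟩ := G₀
    obtain ⟨e⟩ := (hGT ⟨()⟩).2.2 ι₀ hG₀.1
    -- one `ℱ`-level gluing datum per `m ∈ ℤ`, all lying over `G₀`
    let GF : Multiplicative ℤ → GluingDataF FK T.pmBridge T.ellBridge := fun m =>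
      ⟨ι₀, fun t => liftAt (poly₀ t) m, fun t => by
        show DStrip.IsPlusFullPolyIso (FStrip.assocDMap '' liftAt (poly₀ t) m)
        rw [image_liftAt]; exact pf₀ t⟩
    have toD_eq : ∀ (ι : T.pmBridge.dBridge.T ≃ T.ellBridge.dBridge.T)
        (p q : ∀ t, Set ((T.pmBridge.dBridge.capsule t).Iso (T.ellBridge.dBridge.capsule (ι t))))
        (hp : ∀ t, DStrip.IsPlusFullPolyIso (p t)) (hq : ∀ t, DStrip.IsPlusFullPolyIso (q t)),
        (∀ t, p t = q t) → GluingData.mk ι p hp = GluingData.mk ι q hq := by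
      intro ι p q hp hq h
      obtain rfl : p = q := funext h
      rfl
    have hGF_toD : ∀ m, (GF m).toD = ⟨ι₀, poly₀, pf₀⟩ := fun m =>
      toD_eq ι₀ _ poly₀ _ pf₀ (fun t => image_liftAt _ m)
    have hGF_glues : ∀ m, (GF m).Glues := by
      intro m
      show (GF m).toD.Glues
      rw [hGF_toD]; exact hG₀
    let ΓF : Multiplicative ℤ → {G : GluingDataF FK T.pmBridge T.ellBridge // G.Glues ∧ G.indexEquiv = ι₀} :=
      fun m => ⟨GF m, hGF_glues m, rfl⟩
    let t₀ : T.pmBridge.T := (0 : ZMod l)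
    let proj : {G : GluingDataF FK T.pmBridge T.ellBridge // G.Glues ∧ G.indexEquiv = ι₀} →
        Set (Multiplicative ℤ) := fun x => snd '' (show Set (S.Iso S) from x.1.poly t₀)
    have hproj : ∀ m, proj (ΓF m) = {m} := fun m => snd_image_liftAt _ (pf₀ t₀).nonempty m
    have hinj : Function.Injective ΓF := by
      intro m m' h
      have h0 := congrArg proj h
      rw [hproj, hproj] at h0
      exact Set.singleton_eq_singleton_iff.mp h0
    haveI : Infinite {G : GluingDataF FK T.pmBridge T.ellBridge // G.Glues ∧ G.indexEquiv = ι₀} :=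
      Infinite.of_injective ΓF hinj
    exact @not_finite (Unit → ℤˣ) ((Equiv.infinite_iff e).mp inferInstance) inferInstance
  · -- (3) the `ℱ`-level isomorphisms of the Θ^{ell}-bridge of `T` are infinitely many
    obtain ⟨d⟩ := DThetaEllBridge.isoTorsor_nonempty T.ellBridge.dBridge T.ellBridge.dBridge
    let IF : Multiplicative ℤ → ThetaEllBridge.IsoF T.ellBridge T.ellBridge := fun m =>
      ⟨d, fun t => liftAt (d.capsPoly t) m, fun t => image_liftAt _ m⟩
    let t₀ : T.ellBridge.T := (0 : ZMod l)
    let proj : ThetaEllBridge.IsoF T.ellBridge T.ellBridge → Set (Multiplicative ℤ) := fun G =>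
      snd '' (show Set (S.Iso S) from G.capsPoly t₀)
    have hproj : ∀ m, proj (IF m) = {m} := fun m => snd_image_liftAt _ (d.capsPoly_plusFull t₀).nonempty m
    refine Infinite.of_injective IF fun m m' h => ?_
    have h0 := congrArg proj h
    rw [hproj, hproj] at h0
    exact Set.singleton_eq_singleton_iff.mp h0

/-- **[IUTchI] Cor 6.12 (i)** (kurims p.173): there is an `ℱ`-kit (over the toy base kit, prime `l ≠ 2`)
for which the named statement `FKit.Cor612iF` FAILS — its Θ^±-bridge clause already fails: `IsoF.toD` is
not injective when `𝔉 ↦ 𝔇` is not injective on isomorphisms. [claim: Mochizuki2012, status: disputed] -/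
theorem exists_fkit_not_cor612iF (l : ℕ) [Fact l.Prime] (hl : l ≠ 2) :
    ∃ FK : (toyKit l hl).FKit (MultKit.toy l hl), ¬ FK.Cor612iF := by
  obtain ⟨FK, T, h1, -, -, -⟩ := exists_fat_kit l hl
  exact ⟨FK, fun h => h1 (h.1 T.pmBridge T.pmBridge)⟩

/-- **[IUTchI] Cor 6.12 (i)** (kurims p.173), FACT-LIST row F-2605: the universal closure of
`PMBaseKit.FKit.Cor612iF` over all kits `(l, K, M, FK)` is FALSE (witness at `l = 3`); the row is a
SCHEMA whose instance form is `cor612iF_of_isomFtoDBijective` (under Cor 5.3 (ii)).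
[claim: Mochizuki2012, status: disputed] -/
theorem not_forall_cor612iF :
    ¬ ∀ (l : ℕ) (K : PMBaseKit.{0} l) (M : K.MultKit) (FK : K.FKit M), FK.Cor612iF := by
  intro h
  haveI : Fact (Nat.Prime 3) := ⟨Nat.prime_three⟩
  obtain ⟨FK, hFK⟩ := exists_fkit_not_cor612iF 3 (by decide)
  exact hFK (h 3 _ _ FK)

/-- **[IUTchI] Cor 6.12 (ii)** (kurims p.173): there are an `ℱ`-kit (over the toy base kit, prime `l ≠ 2`),
a Θ^±-bridge and a Θ^{ell}-bridge over it for which the named statement `FKit.GluingTorsorF` FAILS: the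
`ℱ`-level gluing data over a fixed index bijection that glue are infinitely many, not a `{±1}^𝕍`-torsor.
[claim: Mochizuki2012, status: disputed] -/
theorem exists_fkit_not_gluingTorsorF (l : ℕ) [Fact l.Prime] (hl : l ≠ 2) :
    ∃ (FK : (toyKit l hl).FKit (MultKit.toy l hl)) (B : FK.ThetaPMBridge) (B' : FK.ThetaEllBridge),
      ¬ FK.GluingTorsorF B B' := by
  obtain ⟨FK, T, -, h2, -, -⟩ := exists_fat_kit l hl
  exact ⟨FK, T.pmBridge, T.ellBridge, h2⟩

/-- **[IUTchI] Cor 6.12 (ii)** (kurims p.173), FACT-LIST row F-2607: the universal closure of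
`PMBaseKit.FKit.GluingTorsorF` over all kits and all pairs of bridges is FALSE (witness at `l = 3`); the
row is a SCHEMA whose instance form is `gluingTorsorF_of_isomFtoDBijective` (under Cor 5.3 (ii); its
Prop 6.6 (iv) input is DISCHARGED, `DThetaPMBridge.gluingTorsor`). [claim: Mochizuki2012, status: disputed] -/
theorem not_forall_gluingTorsorF :
    ¬ ∀ (l : ℕ) (K : PMBaseKit.{0} l) (M : K.MultKit) (FK : K.FKit M) (B : FK.ThetaPMBridge)
      (B' : FK.ThetaEllBridge), FK.GluingTorsorF B B' := by
  intro h
  haveI : Fact (Nat.Prime 3) := ⟨Nat.prime_three⟩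
  obtain ⟨FK, B, B', hFK⟩ := exists_fkit_not_gluingTorsorF 3 (by decide)
  exact hFK (h 3 _ _ FK B B')

/-- **[IUTchI] Rmk 6.12.1** (kurims p.174): there is an `ℱ`-kit (over the toy base kit, prime `l ≠ 2`) for
which the named statement `FKit.FunctorialDynamicsPMF` FAILS: for its toy Θ^{±ell}-Hodge theater the
`ℱ`-level isomorphisms of the Θ^{ell}-bridge are infinitely many, so their `Nat.card` is `0 ≠ 2·l`.
[claim: Mochizuki2012, status: disputed] -/
theorem exists_fkit_not_functorialDynamicsPMF (l : ℕ) [Fact l.Prime] (hl : l ≠ 2) :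
    ∃ FK : (toyKit l hl).FKit (MultKit.toy l hl), ¬ FK.FunctorialDynamicsPMF := by
  obtain ⟨FK, T, -, -, h3, hT⟩ := exists_fat_kit l hl
  refine ⟨FK, fun h => ?_⟩
  have hcard : Nat.card (ThetaEllBridge.IsoF T.ellBridge T.ellBridge) = 2 * Nat.card T.T := (h T ⟨()⟩).2
  haveI := h3
  rw [Nat.card_eq_zero_of_infinite, hT] at hcard
  have h2 := (Fact.out : l.Prime).two_le
  omega

/-- **[IUTchI] Rmk 6.12.1** (kurims p.174), FACT-LIST row F-2608: the universal closure of
`PMBaseKit.FKit.FunctorialDynamicsPMF` over all kits is FALSE (witness at `l = 3`); the row is a SCHEMA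
whose instance form is `functorialDynamicsPMF_of_isomFtoDBijective` (under Cor 5.3 (ii) and the
`𝒟`-level symmetry of Prop 6.8 (i)). [claim: Mochizuki2012, status: disputed] -/
theorem not_forall_functorialDynamicsPMF :
    ¬ ∀ (l : ℕ) (K : PMBaseKit.{0} l) (M : K.MultKit) (FK : K.FKit M), FK.FunctorialDynamicsPMF := by
  intro h
  haveI : Fact (Nat.Prime 3) := ⟨Nat.prime_three⟩
  obtain ⟨FK, hFK⟩ := exists_fkit_not_functorialDynamicsPMF 3 (by decide)
  exact hFK (h 3 _ _ FK)

/-! ### Cor 6.12 (i) at all three levels: `IsoF.toD` is not injective over the fat kit (row F-2604) -/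

/-- **[IUTchI] Cor 6.12 (i)** (kurims p.173), INTERFACE LEVEL, all three cases: over the fat `ℱ`-kit of
`exists_fat_kit` (toy base kit, prime `l ≠ 2`; `𝔉 ↦ 𝔇` surjective but not injective on isomorphisms) and
its Θ^{±ell}-Hodge theater `T`, the natural map `IsoF.toD` is NOT bijective for the Θ^±-bridge of `T`,
for the Θ^{ell}-bridge of `T`, and for `T` itself: in each case one isomorphism of the associated
`𝒟`-objects (Prop 6.6 (i)/(ii)/(iii), DISCHARGED: `DThetaPMBridge.isoTorsor`,
`DThetaEllBridge.isoTorsor_nonempty`, `DThetaPMEllHT.isoTorsor_nonempty`) has two distinct `ℱ`-level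
lifts (all lifts vs. the lifts with trivial `ℤ`-component). [claim: Mochizuki2012, status: disputed] -/
theorem exists_fat_kit_isoF (l : ℕ) [Fact l.Prime] (hl : l ≠ 2) :
    ∃ (FK : (toyKit l hl).FKit (MultKit.toy l hl)) (T : FK.ThetaPMEllHT),
      ¬ ThetaPMBridge.IsoFToDBijective T.pmBridge T.pmBridge ∧
        ¬ ThetaEllBridge.IsoFToDBijective T.ellBridge T.ellBridge ∧
          ¬ ThetaPMEllHT.IsoFToDBijective T T := by
  classical
  haveI : NeZero l := ⟨(Fact.out : l.Prime).ne_zero⟩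
  let H : Type := ℤˣ × Multiplicative ℤ
  let K : PMBaseKit.{0} l := toyKit l hl
  let M : K.MultKit := MultKit.toy l hl
  let π : SingleObj H ⥤ Model.Obj l :=
    { obj := fun _ => Model.Obj.loc
      map := fun f => (show H from f).1
      map_id := fun _ => rfl
      map_comp := fun _ _ => rfl }
  let FK : K.FKit M :=
    { FAmb := fun _ => SingleObj H
      fModel := fun _ => SingleObj.star H
      FmAmb := fun _ => SingleObj H
      fmModel := fun _ => SingleObj.star H
      toD := fun _ => π
      toD_model := fun _ => Iso.refl _
      toFm := fun _ => 𝟭 _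
      toFm_model := fun _ => Iso.refl _
      RlfAmb := ∀ _ : K.V, SingleObj H
      rlfModel := fun _ => SingleObj.star H
      rlfFm := fun v => Pi.eval _ v
      rlfOf := fun F => F
      rlfOfMap := fun φ => Pi.isoMk φ
      rlfFm_rlfOf := fun _ _ => Iso.refl _
      ThAmb := fun _ => SingleObj H
      thModel := fun _ => SingleObj.star H
      thToF := fun _ => 𝟭 _
      thToF_model := fun _ => Iso.refl _
      toDm := fun _ => SingleObj.star _
      toDmMap := fun _ => 𝟙 _
      toDm_toFm := fun _ _ => ⟨𝟙 _⟩ }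
  let S : FK.FStrip := ⟨fun _ => SingleObj.star H, fun _ => ⟨Iso.refl _⟩⟩
  let T : FK.ThetaPMEllHT :=
    { T := ZMod l
      grpT := FlPMGroup.tautological l
      capsule := fun _ => S
      codomain := S
      glob := K.gModel
      dPolyPM := Ex62.poly K
      dPolyEll := Ex63.poly K
      exists_model := (Ex62.ht K).exists_model }
  let lift : (S.assocD.Iso S.assocD) → Multiplicative ℤ → S.Iso S := fun φ m v =>
    (Groupoid.isoEquivHom (SingleObj.star H) (SingleObj.star H)).symm ((φ v).hom, m)
  have lift_assocD : ∀ φ m, FStrip.assocDMap (lift φ m) = φ := by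
    intro φ m
    funext v
    ext
    rfl
  let snd : S.Iso S → Multiplicative ℤ := fun ψ => (show H from (ψ ()).hom).2
  have snd_lift : ∀ φ m, snd (lift φ m) = m := fun _ _ => rfl
  let liftAt : Set (S.assocD.Iso S.assocD) → Multiplicative ℤ → Set (S.Iso S) := fun P m =>
    {ψ | FStrip.assocDMap ψ ∈ P ∧ snd ψ = m}
  have image_liftAt : ∀ P m, FStrip.assocDMap '' liftAt P m = P := by
    intro P m
    apply le_antisymm
    · rintro _ ⟨ψ, hψ, rfl⟩
      exact hψ.1
    · intro φ hφ
      exact ⟨lift φ m, ⟨show FStrip.assocDMap (lift φ m) ∈ P from Set.mem_of_eq_of_mem (lift_assocD φ m) hφ,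
        snd_lift φ m⟩, lift_assocD φ m⟩
  have image_liftPoly : ∀ P : Set (S.assocD.Iso S.assocD), FStrip.assocDMap '' liftPoly P = P := by
    intro P
    apply le_antisymm
    · rintro _ ⟨ψ, hψ, rfl⟩
      exact hψ
    · intro φ hφ
      exact ⟨lift φ 1, show FStrip.assocDMap (lift φ 1) ∈ P from Set.mem_of_eq_of_mem (lift_assocD φ 1) hφ,
        lift_assocD φ 1⟩
  have snd_image_liftAt : ∀ P : Set (S.assocD.Iso S.assocD), P.Nonempty → ∀ m,
      snd '' liftAt P m = {m} := by
    intro P hP m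
    apply le_antisymm
    · rintro _ ⟨ψ, hψ, rfl⟩
      exact hψ.2
    · intro x hx
      rw [Set.mem_singleton_iff.mp hx]
      obtain ⟨φ, hφ⟩ := hP
      exact ⟨lift φ m, ⟨show FStrip.assocDMap (lift φ m) ∈ P from Set.mem_of_eq_of_mem (lift_assocD φ m) hφ,
        snd_lift φ m⟩, snd_lift φ m⟩
  -- all lifts of a nonempty `P` contain a lift with `ℤ`-component `ofAdd 1`, unlike `liftAt P 1`
  have liftPoly_ne_liftAt : ∀ P : Set (S.assocD.Iso S.assocD), P.Nonempty → liftPoly P ≠ liftAt P 1 := by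
    intro P hP h
    obtain ⟨φ, hφ⟩ := hP
    have hmem : lift φ (Multiplicative.ofAdd 1) ∈ liftPoly P :=
      show FStrip.assocDMap (lift φ (Multiplicative.ofAdd 1)) ∈ P from
        Set.mem_of_eq_of_mem (lift_assocD φ _) hφ
    rw [h] at hmem
    have h2 : snd (lift φ (Multiplicative.ofAdd 1)) = 1 := hmem.2
    rw [snd_lift] at h2
    exact absurd h2 (by decide)
  refine ⟨FK, T, ?_, ?_, ?_⟩
  · -- Θ^±-bridges
    intro hbij
    obtain ⟨⟨g⟩, -⟩ := DThetaPMBridge.isoTorsor T.pmBridge.dBridge T.pmBridge.dBridge ⟨()⟩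
    let G₁ : ThetaPMBridge.IsoF T.pmBridge T.pmBridge :=
      ⟨g, fun t => liftPoly (g.capsPoly t), liftPoly g.codPoly, fun t => image_liftPoly _, image_liftPoly _⟩
    let G₂ : ThetaPMBridge.IsoF T.pmBridge T.pmBridge :=
      ⟨g, fun t => liftPoly (g.capsPoly t), liftAt g.codPoly 1, fun t => image_liftPoly _, image_liftAt _ 1⟩
    have hne : G₁ ≠ G₂ := fun h =>
      liftPoly_ne_liftAt _ g.codPoly_plusFull.nonempty (congrArg ThetaPMBridge.IsoF.codPoly h)
    exact hne (hbij.1 (rfl : G₁.toD = G₂.toD))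
  · -- Θ^{ell}-bridges
    intro hbij
    obtain ⟨d⟩ := DThetaEllBridge.isoTorsor_nonempty T.ellBridge.dBridge T.ellBridge.dBridge
    let G₁ : ThetaEllBridge.IsoF T.ellBridge T.ellBridge :=
      ⟨d, fun t => liftPoly (d.capsPoly t), fun t => image_liftPoly _⟩
    let G₂ : ThetaEllBridge.IsoF T.ellBridge T.ellBridge :=
      ⟨d, fun t => liftAt (d.capsPoly t) 1, fun t => image_liftAt _ 1⟩
    let t₀ : T.ellBridge.T := (0 : ZMod l)
    let proj : ThetaEllBridge.IsoF T.ellBridge T.ellBridge → Set (S.Iso S) := fun G =>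
      show Set (S.Iso S) from G.capsPoly t₀
    have hne : G₁ ≠ G₂ := fun h =>
      liftPoly_ne_liftAt _ (d.capsPoly_plusFull t₀).nonempty (congrArg proj h)
    exact hne (hbij.1 (rfl : G₁.toD = G₂.toD))
  · -- Θ^{±ell}-Hodge theaters
    intro hbij
    obtain ⟨i⟩ := DThetaPMEllHT.isoTorsor_nonempty T.dHT T.dHT
    let G₁ : ThetaPMEllHT.IsoF T T :=
      ⟨i, fun t => liftPoly (i.pmIso.capsPoly t), liftPoly i.pmIso.codPoly, fun t => image_liftPoly _,
        image_liftPoly _⟩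
    let G₂ : ThetaPMEllHT.IsoF T T :=
      ⟨i, fun t => liftPoly (i.pmIso.capsPoly t), liftAt i.pmIso.codPoly 1, fun t => image_liftPoly _,
        image_liftAt _ 1⟩
    have hne : G₁ ≠ G₂ := fun h =>
      liftPoly_ne_liftAt _ i.pmIso.codPoly_plusFull.nonempty (congrArg ThetaPMEllHT.IsoF.codPoly h)
    exact hne (hbij.1 (rfl : G₁.toD = G₂.toD))

/-- **[IUTchI] Cor 6.12 (i)** (kurims p.173), FACT-LIST row F-2604 (`IsoFToDBijective`, Θ^±-bridge case):
the universal closure of `PMBaseKit.FKit.ThetaPMBridge.IsoFToDBijective` over all kits and bridges is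
FALSE (witness at `l = 3`); instance form `ThetaPMBridge.isoFToDBijective_of_isomFtoDBijective`.
[claim: Mochizuki2012, status: disputed] -/
theorem not_forall_thetaPMBridge_isoFToDBijective :
    ¬ ∀ (l : ℕ) (K : PMBaseKit.{0} l) (M : K.MultKit) (FK : K.FKit M) (B₁ B₂ : FK.ThetaPMBridge),
      ThetaPMBridge.IsoFToDBijective B₁ B₂ := by
  intro h
  haveI : Fact (Nat.Prime 3) := ⟨Nat.prime_three⟩
  obtain ⟨FK, T, h1, -, -⟩ := exists_fat_kit_isoF 3 (by decide)
  exact h1 (h 3 _ _ FK _ _)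

/-- **[IUTchI] Cor 6.12 (i)** (kurims p.173), FACT-LIST row F-2604 (`IsoFToDBijective`, Θ^{ell}-bridge
case): the universal closure of `PMBaseKit.FKit.ThetaEllBridge.IsoFToDBijective` over all kits and
bridges is FALSE (witness at `l = 3`); instance form `ThetaEllBridge.isoFToDBijective_of_isomFtoDBijective`.
[claim: Mochizuki2012, status: disputed] -/
theorem not_forall_thetaEllBridge_isoFToDBijective :
    ¬ ∀ (l : ℕ) (K : PMBaseKit.{0} l) (M : K.MultKit) (FK : K.FKit M) (B₁ B₂ : FK.ThetaEllBridge),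
      ThetaEllBridge.IsoFToDBijective B₁ B₂ := by
  intro h
  haveI : Fact (Nat.Prime 3) := ⟨Nat.prime_three⟩
  obtain ⟨FK, T, -, h2, -⟩ := exists_fat_kit_isoF 3 (by decide)
  exact h2 (h 3 _ _ FK _ _)

/-- **[IUTchI] Cor 6.12 (i)** (kurims p.173), FACT-LIST row F-2604 (`IsoFToDBijective`, Θ^{±ell}-Hodge
theater case): the universal closure of `PMBaseKit.FKit.ThetaPMEllHT.IsoFToDBijective` over all kits and
Hodge theaters is FALSE (witness at `l = 3`); instance form
`ThetaPMEllHT.isoFToDBijective_of_isomFtoDBijective`. [claim: Mochizuki2012, status: disputed] -/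
theorem not_forall_thetaPMEllHT_isoFToDBijective :
    ¬ ∀ (l : ℕ) (K : PMBaseKit.{0} l) (M : K.MultKit) (FK : K.FKit M) (H₁ H₂ : FK.ThetaPMEllHT),
      ThetaPMEllHT.IsoFToDBijective H₁ H₂ := by
  intro h
  haveI : Fact (Nat.Prime 3) := ⟨Nat.prime_three⟩
  obtain ⟨FK, T, -, -, h3⟩ := exists_fat_kit_isoF 3 (by decide)
  exact h3 (h 3 _ _ FK _ _)

end FKit

end PMBaseKit

end Literature.IUT.HodgeTheaters
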